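import Literature.GroupTheory.CombinatorialGroupTheory.SignedHurwitzExchange
import HarnessLib

/-!
# Kas' cokernel lemma: the surgery presentation of `H₁(∂X(F; l); ℤ)` is `coker(wordProduct l − 1)`
(sub-goal `stub_Kas_cokernelPresentation` of stub `stub_modelsOn_counts`, line `modp-braid-orbits`,
reshape r9, crux `ConvexBisection.AcyclicBisectionExists`, item stmt-SmoothPoincare4-10508)

The ALGEBRAIC heart of Kas' presentation (A. Kas, Pacific J. Math. 89 (1980); Akbulut–Ozbagci
2001, §2; Gompf–Stipsicz 1999, §8.2) of the first homology of the boundary of a Lefschetz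
handlebody `X(F; l) = F × D² ∪ h₁ ∪ ⋯ ∪ hₙ`.  Surgery on `∂(F × D²)` along the vanishing cycles
`γᵢ × {θᵢ}` with page framing `tᵢ = ∓1` presents `H₁(∂X; ℤ)` with generators `H₁(F) = V` (a page just
after the base angle) and the `n` meridians `μⱼ`, and relations

* PAGE relations `Σⱼ B(γⱼ, a) μⱼ = 0` for `a ∈ V` (a torus `a × S¹` punctured by the link), and
* LONGITUDE relations `γᵢ + εᵢ μᵢ + Σ_{j > i} B(γⱼ, γᵢ) μⱼ = 0`, `εᵢ = sgn` of the letter (the framing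
  push-off of the `i`-th attaching circle bounds the core disc of the `i`-th handle; moving the page
  of `γᵢ` back to the base page crosses the handles `j > i`, Picard–Lefschetz in homology),

— the submodule `N(0, l)` of `V × Rⁿ` spanned by these two families (written out in full
below; no definition is introduced).  The theorem of this file,
`kas_coker_equiv` / `stub_Kas_cokernelPresentation`, is the purely algebraic identity

  `(V × Rⁿ) ⧸ N(0, l) ≃ₗ[R] V ⧸ range (wordProduct B l − 1)`

for ANY bilinear `B` vanishing on the diagonal of the letters (`B γᵢ γᵢ = 0`), in particular for
`stdSymp ℤ g`.  Proof: eliminate the meridians one at a time, first letter first — the longitude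
relation of letter `0` expresses `μ₀` through `γ₀` and the `μⱼ`, `j > 0`, and substituting it turns
the page relations `(A a, (B(γⱼ, a))ⱼ)` (bookkept with an auxiliary endomorphism `A`, initially `0`)
into those of the shorter word with `A' = 1 + (A − 1) ∘ T₀`, `T₀` the signed transvection of letter
`0` (`kas_step`); by induction `(V × Rⁿ)/N(A, l) ≅ V / range (1 + (A − 1) ∘ wordProduct l)`
(`kas_coker_equiv_aux`), and `A = 0` gives `V / range (1 − wordProduct l)`.

CONVENTION CHECK (the one place where Conventions (a)–(c) of `LefschetzBasePages.lean` bite): with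
the page relations written with `B(γⱼ, ·)` and the crossing terms `B(γⱼ, γᵢ)` for `j > i` (handles
met between the base page and the page of letter `i`), the coefficient of `μᵢ` in the `i`-th
longitude relation must be `+εᵢ = −pageTwistingᵢ` for the cokernel to be that of
`wordProduct l = T₀ ∘ ⋯ ∘ Tₙ₋₁` (first letter outermost); with `−εᵢ` instead one gets the cokernel of
the REVERSED word, which differs in general (in `SL(2, ℤ)`, `|coker(T_a T_b T_c − 1)| = 2` but
`|coker(T_c T_b T_a − 1)| = 4` for `a = e`, `b = f`, `c = e + f`).

Nothing is asserted; everything is proved; no `sorry`.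
-/

noncomputable section

-- the prescribed namespace `Summit.<P>.<Sub>.…` duplicates `SmoothPoincare4` (P = Sub)
set_option linter.dupNamespace false

open Set Function
open Literature.GroupTheory.CombinatorialGroupTheory.SignedHurwitz

namespace Summit.SmoothPoincare4.SmoothPoincare4.Theorems.AcyclicBisectionExists.ModpBraidOrbits

section Algebra

variable {R : Type*} [CommRing R] {V : Type*} [AddCommGroup V] [Module R V]

/-! ## Quotient transfer along a surjection -/

/-- **Transfer of quotients along a surjection**: if `f : P → P'` is surjective, `N ≤ f⁻¹ N'`,
`N' ≤ f N` and `ker f ≤ N`, then `P ⧸ N ≃ P' ⧸ N'` (`f⁻¹ N' = f⁻¹ (f N) = N + ker f = N` and the first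
isomorphism theorem for `P → P' → P' ⧸ N'`). [folklore] -/
theorem nonempty_quotient_equiv_of_surjective {P P' : Type*} [AddCommGroup P] [Module R P]
    [AddCommGroup P'] [Module R P'] (f : P →ₗ[R] P') (hf : Surjective f) (N : Submodule R P)
    (N' : Submodule R P') (h₁ : N ≤ N'.comap f) (h₂ : N' ≤ N.map f) (h₃ : LinearMap.ker f ≤ N) :
    Nonempty ((P ⧸ N) ≃ₗ[R] (P' ⧸ N')) := by
  have hmap : N.map f = N' := le_antisymm (Submodule.map_le_iff_le_comap.2 h₁) h₂
  have hcomap : N'.comap f = N := by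
    rw [← hmap, Submodule.comap_map_eq, sup_eq_left.2 h₃]
  let g : P →ₗ[R] P' ⧸ N' := N'.mkQ.comp f
  have hg : Surjective g := (Submodule.mkQ_surjective N').comp hf
  have hker : LinearMap.ker g = N := by
    rw [LinearMap.ker_comp, Submodule.ker_mkQ, hcomap]
  exact ⟨(Submodule.quotEquivOfEq N (LinearMap.ker g) hker.symm).trans (g.quotKerEquivOfSurjective hg)⟩

/-! ## Signs and transvections -/

/-- `sgn b * sgn b = 1`. [folklore] -/
theorem sgn_mul_self (b : Bool) : (sgn b : R) * sgn b = 1 := by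
  cases b <;> simp [sgn]

/-- `sgn (!b) = - sgn b`. [folklore] -/
theorem sgn_not (b : Bool) : (sgn (!b) : R) = -sgn b := by
  cases b <;> simp [sgn]

/-- The opposite-sign transvection of a letter `(v, b)`, evaluated: `a ↦ a − ε B(v, a) v`.
[folklore] -/
theorem transvection_not_apply (B : V →ₗ[R] V →ₗ[R] R) (x : V × Bool) (a : V) :
    transvection B (x.1, !x.2) a = a - (sgn x.2 * B x.1 a) • x.1 := by
  rw [transvection_apply, sgn_not, neg_mul, neg_smul, sub_eq_add_neg]

/-- The opposite-sign transvection inverts the transvection of a letter `(v, b)` with `B v v = 0`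
(`t_v^{-ε} t_v^{ε} = 1`). [folklore] -/
theorem transvection_not_transvection (B : V →ₗ[R] V →ₗ[R] R) (x : V × Bool) (hx : B x.1 x.1 = 0)
    (a : V) : transvection B (x.1, !x.2) (transvection B x a) = a := by
  rw [transvection_not_apply, transvection_apply, map_add, map_smul, smul_eq_mul, hx, mul_zero,
    add_zero]
  module

/-- The transvection of a letter `(v, b)` with `B v v = 0` inverts the opposite-sign transvection
(`t_v^{ε} t_v^{-ε} = 1`). [folklore] -/
theorem transvection_transvection_not (B : V →ₗ[R] V →ₗ[R] R) (x : V × Bool) (hx : B x.1 x.1 = 0)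
    (a : V) : transvection B x (transvection B (x.1, !x.2) a) = a := by
  rw [transvection_apply, transvection_not_apply, map_sub, map_smul, smul_eq_mul, hx, mul_zero,
    sub_zero]
  module

/-! ## One elimination step -/

/-- **One elimination step**: `(V × Rⁿ⁺¹) ⧸ N(A, x :: l) ≃ (V × Rⁿ) ⧸ N(1 + (A − 1) t_x, l)` along the
elimination map of the meridian of the first letter `x = (v, b)`,
`f (w, m) = (w − ε m₀ v, (m_{j+1} − ε m₀ B(γⱼ, v))ⱼ)` (subtract `ε m₀` times the longitude relation of
letter `0`, whose `μ₀`-coefficient is `ε`, `ε² = 1`, then forget `μ₀`): `f` is onto with kernel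
`R · (longitude 0)`, kills the longitude relation of letter `0`, carries that of letter `i + 1` to
that of letter `i` of `l`, and carries the page relation of `a` to the page relation of `t_x^{-ε} a`
for the endomorphism `1 + (A − 1) t_x^{ε}` (this uses `B(v, v) = 0`). [folklore] -/
theorem kas_step (B : V →ₗ[R] V →ₗ[R] R) (A : Module.End R V) (x : V × Bool) (hx : B x.1 x.1 = 0)
    (l : List (V × Bool)) :
    Nonempty (((V × (Fin (x :: l).length → R)) ⧸ Submodule.span (R)
        (Set.range (fun a => ((A) a, fun j : Fin (List.length (x :: l)) => (B) (Prod.fst (List.get (x :: l) j)) a))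
        ∪ Set.range (fun i : Fin (List.length (x :: l)) => (Prod.fst (List.get (x :: l) i), Pi.single i (sgn (Prod.snd (List.get (x :: l) i)))
        + fun j : Fin (List.length (x :: l)) => if
        (i : ℕ) < (j : ℕ) then (B) (Prod.fst (List.get (x :: l) j)) (Prod.fst (List.get (x :: l) i)) else 0)))) ≃ₗ[R]
      ((V × (Fin l.length → R)) ⧸ Submodule.span (R)
          (Set.range (fun a => ((1 + (A - 1) * transvection B x) a, fun j : Fin (List.length (l)) => (B) (Prod.fst (List.get (l) j)) a))
          ∪ Set.range (fun i : Fin (List.length (l)) => (Prod.fst (List.get (l) i), Pi.single i (sgn (Prod.snd (List.get (l) i)))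
          + fun j : Fin (List.length (l)) => if
          (i : ℕ) < (j : ℕ) then (B) (Prod.fst (List.get (l) j)) (Prod.fst (List.get (l) i)) else 0))))) := by
  -- the elimination map
  let f : (V × (Fin (l.length + 1) → R)) →ₗ[R] (V × (Fin l.length → R)) :=
    { toFun := fun p =>
        (p.1 - (sgn x.2 * p.2 0) • x.1, fun j => p.2 j.succ - sgn x.2 * p.2 0 * B (l.get j).1 x.1)
      map_add' := fun p q => by
        ext j
        · simp only [Prod.fst_add, Prod.snd_add, Pi.add_apply]
          module
        · simp only [Prod.snd_add, Pi.add_apply]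
          ring
      map_smul' := fun c p => by
        ext j
        · simp only [Prod.smul_fst, Prod.smul_snd, Pi.smul_apply, smul_eq_mul, RingHom.id_apply]
          module
        · simp only [Prod.smul_snd, Pi.smul_apply, smul_eq_mul, RingHom.id_apply]
          ring }
  have hf : ∀ p, f p =
      (p.1 - (sgn x.2 * p.2 0) • x.1, fun j => p.2 j.succ - sgn x.2 * p.2 0 * B (l.get j).1 x.1) :=
    fun p => rfl
  have hsurj : Surjective f := by
    intro q
    refine ⟨(q.1, Fin.cons 0 q.2), ?_⟩
    rw [hf]
    ext j <;> simp
  -- the longitude relation of letter `0`, its coordinates, and `f` kills it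
  have h00 : ((fun i : Fin (List.length (x :: l)) => (Prod.fst (List.get (x :: l) i), Pi.single i (sgn (Prod.snd (List.get (x :: l) i)))
      + fun j : Fin (List.length (x :: l)) => if
      (i : ℕ) < (j : ℕ) then (B) (Prod.fst (List.get (x :: l) j)) (Prod.fst (List.get (x :: l) i)) else 0)) 0 : V × (Fin (x :: l).length → R)).2 0 = sgn x.2 := by
    simp
  have h0s : ∀ j : Fin l.length, ((fun i : Fin (List.length (x :: l)) => (Prod.fst (List.get (x :: l) i), Pi.single i (sgn (Prod.snd (List.get (x :: l) i)))
      + fun j : Fin (List.length (x :: l)) => if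
      (i : ℕ) < (j : ℕ) then (B) (Prod.fst (List.get (x :: l) j)) (Prod.fst (List.get (x :: l) i)) else 0)) 0 : V × (Fin (x :: l).length → R)).2 j.succ = B (l.get j).1 x.1 := fun j => by
    simp [Fin.succ_ne_zero]
  have h01 : ((fun i : Fin (List.length (x :: l)) => (Prod.fst (List.get (x :: l) i), Pi.single i (sgn (Prod.snd (List.get (x :: l) i)))
      + fun j : Fin (List.length (x :: l)) => if
      (i : ℕ) < (j : ℕ) then (B) (Prod.fst (List.get (x :: l) j)) (Prod.fst (List.get (x :: l) i)) else 0)) 0 : V × (Fin (x :: l).length → R)).1 = x.1 := rfl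
  have hzero : f ((fun i : Fin (List.length (x :: l)) => (Prod.fst (List.get (x :: l) i), Pi.single i (sgn (Prod.snd (List.get (x :: l) i)))
      + fun j : Fin (List.length (x :: l)) => if
      (i : ℕ) < (j : ℕ) then (B) (Prod.fst (List.get (x :: l) j)) (Prod.fst (List.get (x :: l) i)) else 0)) 0 : V × (Fin (x :: l).length → R)) = 0 := by
    rw [hf, h00, h01, sgn_mul_self, one_smul, sub_self]
    ext j
    · rfl
    · simp [Fin.succ_ne_zero]
  -- the kernel of `f` is spanned by it
  have hker : LinearMap.ker f ≤ Submodule.span (R)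
      (Set.range (fun a => ((A) a, fun j : Fin (List.length (x :: l)) => (B) (Prod.fst (List.get (x :: l) j)) a))
      ∪ Set.range (fun i : Fin (List.length (x :: l)) => (Prod.fst (List.get (x :: l) i), Pi.single i (sgn (Prod.snd (List.get (x :: l) i)))
      + fun j : Fin (List.length (x :: l)) => if
      (i : ℕ) < (j : ℕ) then (B) (Prod.fst (List.get (x :: l) j)) (Prod.fst (List.get (x :: l) i)) else 0))) := by
    intro p hp
    rw [LinearMap.mem_ker, hf, Prod.ext_iff] at hp
    obtain ⟨h1, h2⟩ := hp
    simp only [Prod.fst_zero, sub_eq_zero] at h1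
    have h2' : ∀ j : Fin l.length, p.2 j.succ = sgn x.2 * p.2 0 * B (l.get j).1 x.1 := fun j => by
      have := congrFun h2 j
      simpa [sub_eq_zero] using this
    have hp : p = (sgn x.2 * p.2 0) • (fun i : Fin (List.length (x :: l)) => (Prod.fst (List.get (x :: l) i), Pi.single i (sgn (Prod.snd (List.get (x :: l) i)))
        + fun j : Fin (List.length (x :: l)) => if
        (i : ℕ) < (j : ℕ) then (B) (Prod.fst (List.get (x :: l) j)) (Prod.fst (List.get (x :: l) i)) else 0)) 0 := by
      ext j
      · rw [Prod.smul_fst, h01]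
        exact h1
      · rw [Prod.smul_snd, Pi.smul_apply, smul_eq_mul]
        refine Fin.cases ?_ (fun j => ?_) j
        · rw [h00, mul_right_comm, sgn_mul_self, one_mul]
        · rw [h0s, h2' j]
    rw [hp]
    exact Submodule.smul_mem _ _ (Submodule.subset_span (Or.inr ⟨0, rfl⟩))
  -- `f` carries the longitude relation of letter `i + 1` to that of letter `i` of `l`
  have hsucc : ∀ i : Fin l.length, f ((fun i : Fin (List.length (x :: l)) => (Prod.fst (List.get (x :: l) i), Pi.single i (sgn (Prod.snd (List.get (x :: l) i)))
      + fun j : Fin (List.length (x :: l)) => if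
      (i : ℕ) < (j : ℕ) then (B) (Prod.fst (List.get (x :: l) j)) (Prod.fst (List.get (x :: l) i)) else 0)) i.succ : V × (Fin (x :: l).length → R)) = (fun i : Fin (List.length (l)) => (Prod.fst (List.get (l) i), Pi.single i (sgn (Prod.snd (List.get (l) i)))
      + fun j : Fin (List.length (l)) => if (i : ℕ) < (j : ℕ) then (B) (Prod.fst (List.get (l) j)) (Prod.fst (List.get (l) i)) else 0)) i := fun i => by
    have hi0 : ((fun i : Fin (List.length (x :: l)) => (Prod.fst (List.get (x :: l) i), Pi.single i (sgn (Prod.snd (List.get (x :: l) i)))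
        + fun j : Fin (List.length (x :: l)) => if
        (i : ℕ) < (j : ℕ) then (B) (Prod.fst (List.get (x :: l) j)) (Prod.fst (List.get (x :: l) i)) else 0)) i.succ : V × (Fin (x :: l).length → R)).2 0 = 0 := by
      simp [(Fin.succ_ne_zero i).symm]
    have hi1 : ((fun i : Fin (List.length (x :: l)) => (Prod.fst (List.get (x :: l) i), Pi.single i (sgn (Prod.snd (List.get (x :: l) i)))
        + fun j : Fin (List.length (x :: l)) => if
        (i : ℕ) < (j : ℕ) then (B) (Prod.fst (List.get (x :: l) j)) (Prod.fst (List.get (x :: l) i)) else 0)) i.succ : V × (Fin (x :: l).length → R)).1 = (l.get i).1 := rfl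
    rw [hf, hi0, hi1, mul_zero, zero_smul, sub_zero]
    ext j
    · rfl
    · simp [Pi.single_apply, Fin.succ_inj]
  -- `f` carries the page relation of `a` to the page relation of `t_x^{-ε} a` for `1 + (A − 1) t_x`
  have hpage : ∀ a : V, f ((fun a => ((A) a, fun j : Fin (List.length (x :: l)) => (B) (Prod.fst (List.get (x :: l) j)) a)) a : V × (Fin (x :: l).length → R)) =
      (fun a => ((1 + (A - 1) * transvection B x) a, fun j : Fin (List.length (l)) => (B) (Prod.fst (List.get (l) j)) a)) (transvection B (x.1, !x.2) a) := fun a => by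
    have ha0 : ((fun a => ((A) a, fun j : Fin (List.length (x :: l)) => (B) (Prod.fst (List.get (x :: l) j)) a)) a : V × (Fin (x :: l).length → R)).2 0 = B x.1 a := rfl
    have ha1 : ((fun a => ((A) a, fun j : Fin (List.length (x :: l)) => (B) (Prod.fst (List.get (x :: l) j)) a)) a : V × (Fin (x :: l).length → R)).1 = A a := rfl
    have has : ∀ j : Fin l.length, ((fun a => ((A) a, fun j : Fin (List.length (x :: l)) => (B) (Prod.fst (List.get (x :: l) j)) a)) a : V × (Fin (x :: l).length → R)).2 j.succ = B (l.get j).1 a := fun j => rfl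
    rw [hf, ha0, ha1]
    ext j
    · show A a - (sgn x.2 * B x.1 a) • x.1 =
        (1 + (A - 1) * transvection B x) (transvection B (x.1, !x.2) a)
      rw [LinearMap.add_apply, Module.End.mul_apply, transvection_transvection_not B x hx,
        Module.End.one_apply, LinearMap.sub_apply, Module.End.one_apply, transvection_not_apply]
      module
    · show ((fun a => ((A) a, fun j : Fin (List.length (x :: l)) => (B) (Prod.fst (List.get (x :: l) j)) a)) a : V × (Fin (x :: l).length → R)).2 j.succ - sgn x.2 * B x.1 a * B (l.get j).1 x.1 =
        B (l.get j).1 (transvection B (x.1, !x.2) a)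
      rw [has, transvection_not_apply, map_sub, map_smul, smul_eq_mul]
  -- transfer of quotients along `f`
  refine nonempty_quotient_equiv_of_surjective f hsurj _ _ ?_ ?_ hker
  · -- `N ≤ f⁻¹ N'`
    rw [Submodule.span_le]
    refine Set.union_subset (Set.range_subset_iff.2 fun a => ?_) (Set.range_subset_iff.2 fun i => ?_)
    · rw [SetLike.mem_coe, Submodule.mem_comap, hpage a]
      exact Submodule.subset_span (Or.inl ⟨_, rfl⟩)
    · rw [SetLike.mem_coe, Submodule.mem_comap]
      refine Fin.cases ?_ (fun i => ?_) i
      · rw [hzero]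
        exact Submodule.zero_mem _
      · rw [hsucc i]
        exact Submodule.subset_span (Or.inr ⟨i, rfl⟩)
  · -- `N' ≤ f N`
    rw [Submodule.span_le]
    refine Set.union_subset (Set.range_subset_iff.2 fun d => ?_) (Set.range_subset_iff.2 fun i => ?_)
    · have hmem : f ((fun a => ((A) a, fun j : Fin (List.length (x :: l)) => (B) (Prod.fst (List.get (x :: l) j)) a)) (transvection B x d) : V × (Fin (x :: l).length → R)) ∈ (Submodule.span (R)
        (Set.range (fun a => ((A) a, fun j : Fin (List.length (x :: l)) => (B) (Prod.fst (List.get (x :: l) j)) a))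
        ∪ Set.range (fun i : Fin (List.length (x :: l)) => (Prod.fst (List.get (x :: l) i), Pi.single i (sgn (Prod.snd (List.get (x :: l) i)))
        + fun j : Fin (List.length (x :: l)) => if
        (i : ℕ) < (j : ℕ) then (B) (Prod.fst (List.get (x :: l) j)) (Prod.fst (List.get (x :: l) i)) else 0)))).map f :=
        Submodule.mem_map_of_mem (Submodule.subset_span (Or.inl ⟨_, rfl⟩))
      rw [hpage, transvection_not_transvection B x hx] at hmem
      exact hmem
    · have hmem : f ((fun i : Fin (List.length (x :: l)) => (Prod.fst (List.get (x :: l) i), Pi.single i (sgn (Prod.snd (List.get (x :: l) i)))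
        + fun j : Fin (List.length (x :: l)) => if
        (i : ℕ) < (j : ℕ) then (B) (Prod.fst (List.get (x :: l) j)) (Prod.fst (List.get (x :: l) i)) else 0)) i.succ : V × (Fin (x :: l).length → R)) ∈ (Submodule.span (R)
        (Set.range (fun a => ((A) a, fun j : Fin (List.length (x :: l)) => (B) (Prod.fst (List.get (x :: l) j)) a))
        ∪ Set.range (fun i : Fin (List.length (x :: l)) => (Prod.fst (List.get (x :: l) i), Pi.single i (sgn (Prod.snd (List.get (x :: l) i)))
        + fun j : Fin (List.length (x :: l)) => if
        (i : ℕ) < (j : ℕ) then (B) (Prod.fst (List.get (x :: l) j)) (Prod.fst (List.get (x :: l) i)) else 0)))).map f :=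
        Submodule.mem_map_of_mem (Submodule.subset_span (Or.inr ⟨_, rfl⟩))
      rw [hsucc i] at hmem
      exact hmem

/-! ## The induction -/

/-- **The empty word**: `(V × R⁰) ⧸ N(A, []) ≃ V ⧸ range A`. [folklore] -/
theorem kas_nil (B : V →ₗ[R] V →ₗ[R] R) (A : Module.End R V) :
    Nonempty (((V × (Fin ([] : List (V × Bool)).length → R)) ⧸ Submodule.span (R)
        (Set.range (fun a => ((A) a, fun j : Fin (List.length (([] : List (V × Bool)))) => (B) (Prod.fst (List.get (([] : List (V × Bool))) j)) a))
        ∪ Set.range (fun i : Fin (List.length (([] : List (V × Bool)))) => (Prod.fst (List.get (([] : List (V × Bool))) i), Pi.single i (sgn (Prod.snd (List.get (([] : List (V × Bool))) i)))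
        + fun j : Fin (List.length (([] : List (V × Bool)))) => if
        (i : ℕ) < (j : ℕ) then (B) (Prod.fst (List.get (([] : List (V × Bool))) j)) (Prod.fst (List.get (([] : List (V × Bool))) i)) else 0))))
      ≃ₗ[R] (V ⧸ LinearMap.range A)) := by
  refine nonempty_quotient_equiv_of_surjective (LinearMap.fst R V _) LinearMap.fst_surjective _ _ ?_ ?_ ?_
  · rw [Submodule.span_le]
    refine Set.union_subset (Set.range_subset_iff.2 fun a => ?_) (Set.range_subset_iff.2 fun i => ?_)
    · exact ⟨a, rfl⟩
    · exact i.elim0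
  · rintro _ ⟨a, rfl⟩
    exact ⟨(fun a => ((A) a, fun j : Fin (List.length (([] : List (V × Bool)))) => (B) (Prod.fst (List.get (([] : List (V × Bool))) j)) a)) a, Submodule.subset_span (Or.inl ⟨a, rfl⟩), rfl⟩
  · intro p hp
    rw [LinearMap.mem_ker, LinearMap.fst_apply] at hp
    have : p = 0 := Prod.ext hp (funext fun i => i.elim0)
    rw [this]
    exact Submodule.zero_mem _

/-- **Kas' cokernel lemma, bookkept form**: for a bilinear form vanishing on the diagonal of the
letters, `(V × Rⁿ) ⧸ N(A, l) ≃ V ⧸ range (1 + (A − 1) ∘ wordProduct l)` — by induction on the word,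
one elimination step per letter (`kas_step`: `A ↦ 1 + (A − 1) t_x`, and
`(1 + (A − 1) t_x − 1) ∘ wordProduct l = (A − 1) ∘ wordProduct (x :: l)`). [cite: Kas1980] -/
theorem kas_coker_equiv_aux (B : V →ₗ[R] V →ₗ[R] R) :
    ∀ (l : List (V × Bool)), (∀ x ∈ l, B x.1 x.1 = 0) → ∀ A : Module.End R V,
      Nonempty (((V × (Fin l.length → R)) ⧸ Submodule.span (R)
          (Set.range (fun a => ((A) a, fun j : Fin (List.length (l)) => (B) (Prod.fst (List.get (l) j)) a))
          ∪ Set.range (fun i : Fin (List.length (l)) => (Prod.fst (List.get (l) i), Pi.single i (sgn (Prod.snd (List.get (l) i)))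
          + fun j : Fin (List.length (l)) => if
          (i : ℕ) < (j : ℕ) then (B) (Prod.fst (List.get (l) j)) (Prod.fst (List.get (l) i)) else 0)))) ≃ₗ[R]
        (V ⧸ LinearMap.range (1 + (A - 1) * wordProduct B l))) := by
  intro l
  induction l with
  | nil =>
    intro _ A
    obtain ⟨e⟩ := kas_nil B A
    have hA : 1 + (A - 1) * wordProduct B ([] : List (V × Bool)) = A := by
      rw [wordProduct_nil, mul_one, add_sub_cancel]
    exact ⟨e.trans (Submodule.quotEquivOfEq _ _ (by rw [hA]))⟩
  | cons x l ih =>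
    intro hl A
    have hx : B x.1 x.1 = 0 := hl x (List.mem_cons_self)
    obtain ⟨e₁⟩ := kas_step B A x hx l
    obtain ⟨e₂⟩ := ih (fun y hy => hl y (List.mem_cons_of_mem x hy)) (1 + (A - 1) * transvection B x)
    have hA : 1 + (1 + (A - 1) * transvection B x - 1) * wordProduct B l =
        1 + (A - 1) * wordProduct B (x :: l) := by
      rw [wordProduct_cons, add_sub_cancel_left, mul_assoc]
    exact ⟨e₁.trans (e₂.trans (Submodule.quotEquivOfEq _ _ (by rw [hA])))⟩

/-- **Kas' cokernel lemma**: for a bilinear form `B` vanishing on the diagonal of the letters of the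
signed word `l`, the quotient of `V × Rⁿ` by the page relations `(0, (B(γⱼ, a))ⱼ)` and the
longitude relations `(γᵢ, εᵢ eᵢ + Σ_{j>i} B(γⱼ, γᵢ) eⱼ)` is the cokernel of `wordProduct B l − 1` —
Kas' `H₁(∂X(F; l); ℤ) ≅ coker(μ_* − 1)` in its algebraic form (Kas 1980; Akbulut–Ozbagci 2001 §2).
[cite: Kas1980] -/
theorem kas_coker_equiv (B : V →ₗ[R] V →ₗ[R] R) (l : List (V × Bool))
    (hl : ∀ x ∈ l, B x.1 x.1 = 0) :
    Nonempty (((V × (Fin l.length → R)) ⧸ Submodule.span R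
        (Set.range (fun a : V => ((0 : V), fun j : Fin l.length => B (l.get j).1 a)) ∪
          Set.range (fun i : Fin l.length => ((l.get i).1, Pi.single i (sgn (l.get i).2) +
            fun j : Fin l.length => if (i : ℕ) < (j : ℕ) then B (l.get j).1 (l.get i).1 else 0)))) ≃ₗ[R]
      (V ⧸ LinearMap.range (wordProduct B l - 1))) := by
  obtain ⟨e⟩ := kas_coker_equiv_aux B l hl 0
  have h : LinearMap.range (1 + (0 - 1) * wordProduct B l) = LinearMap.range (wordProduct B l - 1) := by
    rw [zero_sub, neg_one_mul, ← sub_eq_add_neg, ← neg_sub, LinearMap.range_neg]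
  have hP : Submodule.span (R) (Set.range (fun a => (((0 : Module.End R V)) a, fun j : Fin (List.length (l)) => (B) (Prod.fst (List.get (l) j)) a))
      ∪ Set.range (fun i : Fin (List.length (l)) => (Prod.fst (List.get (l) i), Pi.single i (sgn (Prod.snd (List.get (l) i)))
      + fun j : Fin (List.length (l)) => if (i : ℕ) < (j : ℕ) then (B) (Prod.fst (List.get (l) j)) (Prod.fst (List.get (l) i)) else 0))) = Submodule.span R
      (Set.range (fun a : V => ((0 : V), fun j : Fin l.length => B (l.get j).1 a)) ∪
        Set.range (fun i : Fin l.length => ((l.get i).1, Pi.single i (sgn (l.get i).2) +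
          fun j : Fin l.length => if (i : ℕ) < (j : ℕ) then B (l.get j).1 (l.get i).1 else 0))) := rfl
  exact ⟨(Submodule.quotEquivOfEq _ _ hP).symm.trans (e.trans (Submodule.quotEquivOfEq _ _ h))⟩

end Algebra

/-! ## The registered sub-goal: the standard symplectic lattice -/

section SubGoal

/-- **Sub-goal `stub_Kas_cokernelPresentation` of stub `stub_modelsOn_counts`** (line
`modp-braid-orbits`, r9): Kas' cokernel lemma over the standard symplectic lattice
`ℤ^{2g} = H₁(F_{g,1}; ℤ)` — the quotient of `ℤ^{2g} × ℤⁿ` by the page relations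
`(0, (stdSymp γⱼ a)ⱼ)` and the longitude relations
`(γᵢ, εᵢ eᵢ + Σ_{j>i} stdSymp γⱼ γᵢ eⱼ)` of the signed word `l` is `ℤ^{2g} ⧸ range (wordProduct l − 1)`
(Kas 1980; Akbulut–Ozbagci 2001, §2; the algebra of Gompf–Stipsicz 1999 §8.2's
`H₁(∂X; ℤ) = coker(μ_* − 1)`). [cite: Kas1980] -/
theorem stub_Kas_cokernelPresentation :
    ∀ (g : ℕ) (l : List ((Fin g ⊕ Fin g → ℤ) × Bool)),
      Nonempty ((((Fin g ⊕ Fin g → ℤ) × (Fin l.length → ℤ)) ⧸ Submodule.span ℤ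
        (Set.range (fun a : Fin g ⊕ Fin g → ℤ => ((0 : Fin g ⊕ Fin g → ℤ), fun j : Fin l.length =>
            Literature.GroupTheory.CombinatorialGroupTheory.SignedHurwitz.stdSymp ℤ g (l.get j).1 a)) ∪
          Set.range (fun i : Fin l.length => ((l.get i).1,
            Pi.single i (Literature.GroupTheory.CombinatorialGroupTheory.SignedHurwitz.sgn (l.get i).2) +
              fun j : Fin l.length => if (i : ℕ) < j then
                Literature.GroupTheory.CombinatorialGroupTheory.SignedHurwitz.stdSymp ℤ g (l.get j).1
                  (l.get i).1 else 0)))) ≃ₗ[ℤ]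
        ((Fin g ⊕ Fin g → ℤ) ⧸ LinearMap.range
          (Literature.GroupTheory.CombinatorialGroupTheory.SignedHurwitz.wordProduct
            (Literature.GroupTheory.CombinatorialGroupTheory.SignedHurwitz.stdSymp ℤ g) l - 1))) :=
  fun g l => kas_coker_equiv (stdSymp ℤ g) l fun x _ => stdSymp_int_self g x.1

end SubGoal

end Summit.SmoothPoincare4.SmoothPoincare4.Theorems.AcyclicBisectionExists.ModpBraidOrbits

end
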